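import Summits.ResolutionOfSingularities.ResolutionOfSingularities.Theorems.EquisingularLiftEquisingularLiftNatDirectionChartData
import HarnessLib

/-!
# [OURS · L1 W4.5b · T-DIRLIFT-UP route C, brick C1c] Direction sections: T-P1VB's input block from a downstairs direction,
# with the chart dictionary

Cell res-hironaka, LADDER-RESOLUTION rung L, slot W4.5(b), crux chain w45b (EL♮(3) = stmt-ResolutionOfSingularities-20148); object
T-DIRLIFT-UP (res-L1-w45b-plan-1 RULING 19:14:55Z, route C), brick **C1c** (`L/res-D-pv-051/TARGET-C1c.sig.lean`; signature v1 =
universe pinned to `Scheme.{0}`, otherwise verbatim). `--supports stmt-ResolutionOfSingularities-20148 --as helper`. THEOREMS ONLY;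
def-free; NOT a statement of any manuscript; AI-written, AI review weaker than expert review.

WHAT. `exists_directionSections`: from the in-carrier curve `C = V(I) ↪ X₀` (regular immersion of codimension 2), morphisms
`Y' —g→ Y —ε→ C`, the trace ideal `Ī = I·𝒪_{G₀}` on `G₀ —j₀→ X₀`, `ψ : Y' → V(Ī)` over `g ≫ ε`, and a DIRECTION `𝒟'` along `Ī`:
a point-indexed cover `U` of `Y'`, sections `w_p` of `G := g^* ε^* 𝒞_{C/X₀}` over `U_p` with functionals `ρ_p(w_p) = 1`, proportional on
overlaps (C1b's input block verbatim — so `L₀ := lineBundle (proportionalCocycle U hU w ρ hρ hprop)`, `ι₀`, `hsplit` come from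
p563530), AND the chart DICTIONARY (conormal chart `(V, x, s)` at the image point, affine `W ∋ ψ(p)` with coefficients `α` such that
`w_p = Σ_j ψ♯(α_j) · g^*ε^*η(s_j)|` and `𝒟'(W) = (Σ_j α_j · j₀♯x_j) + Ī(W)²`). Proof: `exists_directionChartData` at every point (part 1,
`…NatDirectionChartData`), `w_p := Σ ψ♯(α_j) b_j|` in the doubly pulled-back conormal frame, `ρ_p` by B3, proportionality LOCALLY by the
change of generators carried to the frames (`map_basisSection_eq_sum_of_changeOfGenerators`) against the downstairs transition unit
(`exists_unit_of_presentations_eq`) — congruences mod `Ī` become equalities under `ψ♯` — and globally by B4 `hprop_of_locally`.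
-/

noncomputable section

open CategoryTheory CategoryTheory.Limits AlgebraicGeometry Opposite TopologicalSpace
open Literature.AlgebraicGeometry.Modules Literature.AlgebraicGeometry.Morphisms
open Literature.AlgebraicGeometry.Deformation Literature.AlgebraicGeometry.Motives
open Literature.AlgebraicGeometry.HodgeTheory Literature.AlgebraicGeometry.Resolution
open Summit.ResolutionOfSingularities.ResolutionOfSingularities.Cruxes.EquisingularLiftNat.Sections

set_option linter.dupNamespace false -- mandated namespace `Summit.<Summit>.<Problem>` of this single-conjunct summit

namespace Summit.ResolutionOfSingularities.ResolutionOfSingularities.Cruxes.EquisingularLiftNat.P1VB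

/-- Restriction of module sections along any two parallel composites agrees (opens form a preorder). [folklore] -/
theorem presheaf_map_congr {Y : Scheme.{0}} (G : Y.Modules) {A B : Y.Opens} (k k' : B ⟶ A) (t : Γ(G, A)) :
    G.presheaf.map k.op t = G.presheaf.map k'.op t := by rw [Subsingleton.elim k k']

/-- **C1c — direction sections.** See the module docstring. [OURS · L1 W4.5b · T-DIRLIFT-UP route C, brick C1c; NOT a statement of
the manuscript] -/
theorem exists_directionSections
    {X₀ G₀ Y Y' : Scheme.{0}} (j₀ : G₀ ⟶ X₀) [IsLocallyNoetherian X₀] [IsLocallyNoetherian G₀]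
    (I : X₀.IdealSheafData) (hri : IsRegularImmersionOfCodim I.subschemeι 2)
    (ε : Y ⟶ I.subscheme) (g : Y' ⟶ Y)
    (Ī : G₀.IdealSheafData) (hĪ : I.comap j₀ = Ī)
    (ψ : Y' ⟶ Ī.subscheme) (hψ : ψ ≫ Ī.subschemeι ≫ j₀ = g ≫ ε ≫ I.subschemeι)
    (𝒟' : G₀.IdealSheafData)
    (hdir' : ∀ z ∈ Ī.support, ∃ c : Fin 2 → G₀.presheaf.stalk z,
      Ideal.span (Set.range c) = stalkIdeal Ī z ∧ IsQuasiRegular c ∧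
      stalkIdeal 𝒟' z = Ideal.span {c 0} ⊔ Ideal.span {c 1 * c 1}) :
    ∃ (U : Y' → Y'.Opens) (_ : ∀ p, p ∈ U p)
      (w : ∀ p, Γ((Scheme.Modules.pullback g).obj ((Scheme.Modules.pullback ε).obj (conormalSheaf I.subschemeι)), U p))
      (ρ : ∀ p, ((Scheme.Modules.pullback g).obj ((Scheme.Modules.pullback ε).obj (conormalSheaf I.subschemeι))).over (U p) ⟶
        (unitModule Y').over (U p)),
      (∀ p, @Eq Γ(Y', U p) (appLE (ρ p) (𝟙 (U p)) (w p)) 1) ∧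
      (∀ (p p' : Y') (V : Y'.Opens) (hp : V ≤ U p) (hp' : V ≤ U p'), ∃ u : Γ(Y', V),
        ((Scheme.Modules.pullback g).obj ((Scheme.Modules.pullback ε).obj (conormalSheaf I.subschemeι))).presheaf.map
            (homOfLE hp').op (w p') =
          u • ((Scheme.Modules.pullback g).obj ((Scheme.Modules.pullback ε).obj (conormalSheaf I.subschemeι))).presheaf.map
            (homOfLE hp).op (w p)) ∧
      ∀ p, ∃ (V : X₀.affineOpens) (x : Fin 2 → Γ(X₀, (V : X₀.Opens))) (s : Fin 2 → Γ(idealModule I.subschemeι, (V : X₀.Opens)))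
        (_ : RingTheory.Sequence.IsWeaklyRegular Γ(X₀, (V : X₀.Opens)) (List.ofFn x))
        (_ : Ideal.span (Set.range x) = I.ideal V)
        (_ : ∀ j, toRing (idealModuleι I.subschemeι) (V : X₀.Opens) (s j) = x j)
        (hUV : U p ≤ g ⁻¹ᵁ (ε ⁻¹ᵁ (I.subschemeι ⁻¹ᵁ (V : X₀.Opens))))
        (W : G₀.affineOpens) (hWV : (W : G₀.Opens) ≤ j₀ ⁻¹ᵁ (V : X₀.Opens))
        (hUW : U p ≤ (ψ ≫ Ī.subschemeι) ⁻¹ᵁ (W : G₀.Opens))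
        (α : Fin 2 → Γ(G₀, (W : G₀.Opens))),
        w p = ∑ j, (ψ ≫ Ī.subschemeι).appLE (W : G₀.Opens) (U p) hUW (α j) •
          ((Scheme.Modules.pullback g).obj ((Scheme.Modules.pullback ε).obj (conormalSheaf I.subschemeι))).presheaf.map
            (homOfLE hUV).op
            (unitSection g ((Scheme.Modules.pullback ε).obj (conormalSheaf I.subschemeι)) (ε ⁻¹ᵁ (I.subschemeι ⁻¹ᵁ (V : X₀.Opens)))
              (unitSection ε (conormalSheaf I.subschemeι) (I.subschemeι ⁻¹ᵁ (V : X₀.Opens))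
                (unitSectionLE I.subschemeι (idealModule I.subschemeι) (le_refl (I.subschemeι ⁻¹ᵁ (V : X₀.Opens))) (s j)))) ∧
        𝒟'.ideal W = Ideal.span {∑ j, α j * j₀.appLE (V : X₀.Opens) (W : G₀.Opens) hWV (x j)} ⊔ (Ī.ideal W) ^ 2 := by
  classical
  -- notation
  let iC := I.subschemeι
  let 𝒞 : (I.subscheme).Modules := conormalSheaf I.subschemeι
  let G : Y'.Modules := (Scheme.Modules.pullback g).obj ((Scheme.Modules.pullback ε).obj (conormalSheaf I.subschemeι))
  let φ : Y' ⟶ G₀ := ψ ≫ Ī.subschemeι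
  have hφ : φ ≫ j₀ = g ≫ ε ≫ I.subschemeι := by rw [Category.assoc]; exact hψ
  have hpt : ∀ q : Y', j₀ (φ q) = I.subschemeι (ε (g q)) := fun q => by
    change (φ ≫ j₀) q = (g ≫ ε ≫ I.subschemeι) q
    rw [hφ]
  have hyS : ∀ q : Y', φ q ∈ Ī.support := fun q => by
    have h : φ q ∈ (Ī.support : Set G₀) := by
      rw [← Scheme.IdealSheafData.range_subschemeι]
      exact ⟨ψ q, rfl⟩
    exact h
  -- Step 1: chart data at every point
  choose V x s hreg hspan hs e he W hWV hyW α a hu hĪW h𝒟W using fun p : Y' =>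
    exists_directionChartData j₀ I hri Ī hĪ 𝒟' hdir' (φ p) (hyS p) (ε (g p)) (hpt p)
  -- Step 2: the cover, the coefficients, the sections
  let U : Y' → Y'.Opens := fun p => φ ⁻¹ᵁ (W p : G₀.Opens)
  have hU : ∀ p, p ∈ U p := fun p => hyW p
  have hUV : ∀ p, U p ≤ g ⁻¹ᵁ (ε ⁻¹ᵁ (I.subschemeι ⁻¹ᵁ (V p : X₀.Opens))) := by
    intro p q hq
    change I.subschemeι (ε (g q)) ∈ (V p : X₀.Opens)
    rw [← hpt]
    exact hWV p hq
  let ab : ∀ p, Fin 2 → Γ(Y', U p) := fun p j => φ.appLE (W p) (U p) le_rfl (α p j)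
  let bS : ∀ p, Fin 2 → Γ(G, g ⁻¹ᵁ (ε ⁻¹ᵁ (I.subschemeι ⁻¹ᵁ (V p : X₀.Opens)))) := fun p j =>
    basisSection (E := G) (pullbackFrame g (pullbackFrame ε (e p))) j
  let w : ∀ p, Γ(G, U p) := fun p => ∑ j, ab p j • G.presheaf.map (homOfLE (hUV p)).op (bS p j)
  -- Step 3: the functionals (B3)
  have hunimod : ∀ p, ∑ j, φ.appLE (W p) (U p) le_rfl (a p j) * ab p j = 1 := by
    intro p
    have h := appLE_comp_subschemeι_eq_of_sub_mem Ī ψ (W p) (U p) le_rfl (hu p)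
    rw [map_one, map_sum] at h
    simpa only [map_mul] using h
  have hρ' : ∀ p, ∃ ρ : G.over (U p) ⟶ (unitModule Y').over (U p), @Eq Γ(Y', U p) (appLE ρ (𝟙 (U p)) (w p)) 1 := fun p =>
    exists_functional_of_unimodular_comb (pullbackFrame g (pullbackFrame ε (e p))) (homOfLE (hUV p)) (ab p) _ (hunimod p)
  choose ρ hρ using hρ'
  -- Step 4: local proportionality
  -- restriction calculus for `w`, `ab` and `φ♯`
  have map_w : ∀ (p : Y') {V' : Y'.Opens} (k : V' ⟶ U p), G.presheaf.map k.op (w p) =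
      ∑ j, Y'.presheaf.map k.op (ab p j) • G.presheaf.map (k ≫ homOfLE (hUV p)).op (bS p j) := by
    intro p V' k
    change G.presheaf.map k.op (∑ j, ab p j • G.presheaf.map (homOfLE (hUV p)).op (bS p j)) = _
    rw [map_sum]
    refine Finset.sum_congr rfl fun j _ => ?_
    rw [Scheme.Modules.map_smul, presheaf_map_map]
  have appLE_res : ∀ {A A' : G₀.Opens} (hA : A' ≤ A) {B B' : Y'.Opens} (k : B' ⟶ B) (e : B ≤ φ ⁻¹ᵁ A) (e' : B' ≤ φ ⁻¹ᵁ A')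
      (t : Γ(G₀, A)), Y'.presheaf.map k.op (φ.appLE A B e t) = φ.appLE A' B' e' (secRes G₀ hA t) := by
    intro A A' hA B B' k e e' t
    change (φ.appLE A B e ≫ Y'.presheaf.map k.op) t = (G₀.presheaf.map (homOfLE hA).op ≫ φ.appLE A' B' e') t
    rw [Scheme.Hom.appLE_map, Scheme.Hom.map_appLE]
  have appLE_congr' : ∀ {f₁ f₂ : Y' ⟶ X₀}, f₁ = f₂ → ∀ (A : X₀.Opens) (B : Y'.Opens) (e₁ : B ≤ f₁ ⁻¹ᵁ A) (e₂ : B ≤ f₂ ⁻¹ᵁ A)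
      (t : Γ(X₀, A)), f₁.appLE A B e₁ t = f₂.appLE A B e₂ t := fun h => by subst h; intros; rfl
  have appLE_j₀ : ∀ {A : X₀.Opens} {A' : G₀.Opens} (hA : A' ≤ j₀ ⁻¹ᵁ A) {B' : Y'.Opens} (e' : B' ≤ φ ⁻¹ᵁ A')
      (e : B' ≤ g ⁻¹ᵁ (ε ⁻¹ᵁ (I.subschemeι ⁻¹ᵁ A))) (t : Γ(X₀, A)),
      φ.appLE A' B' e' (j₀.appLE A A' hA t) =
        Y'.presheaf.map (homOfLE e).op (g.app _ (ε.app _ (I.subschemeι.app A t))) := by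
    intro A A' hA B' e' e t
    change (j₀.appLE A A' hA ≫ φ.appLE A' B' e') t = _
    rw [Scheme.Hom.appLE_comp_appLE, appLE_congr' hφ A B' _ e, Scheme.Hom.comp_appLE, Scheme.Hom.comp_app]
    rfl
  have hloc : ∀ (p p' q : Y'), q ∈ U p → q ∈ U p' →
      ∃ (V' : Y'.Opens) (_ : q ∈ V') (hz : V' ≤ U p) (hz' : V' ≤ U p') (u : Γ(Y', V')),
        G.presheaf.map (homOfLE hz').op (w p') = u • G.presheaf.map (homOfLE hz).op (w p) := by
    intro p p' q hq hq'
    have hyq : φ q ∈ (W p : G₀.Opens) := hq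
    have hyq' : φ q ∈ (W p' : G₀.Opens) := hq'
    have hxV : I.subschemeι (ε (g q)) ∈ (V p : X₀.Opens) := hUV p hq
    have hxV' : I.subschemeι (ε (g q)) ∈ (V p' : X₀.Opens) := hUV p' hq'
    -- (a) an affine `V''` below `V p ⊓ V p'` around the image point upstairs
    obtain ⟨V''o, hV''aff, hxV'', hV''le⟩ := exists_isAffineOpen_mem_and_subset
      (show I.subschemeι (ε (g q)) ∈ (V p : X₀.Opens) ⊓ V p' from ⟨hxV, hxV'⟩)
    let V'' : X₀.affineOpens := ⟨V''o, hV''aff⟩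
    have h1 : (V'' : X₀.Opens) ≤ V p := fun _ h => (hV''le h).1
    have h2 : (V'' : X₀.Opens) ≤ V p' := fun _ h => (hV''le h).2
    -- (b) change of generators and (f) the induced relation of the pulled-back frames
    obtain ⟨N, hN⟩ := exists_changeOfGenerators I h1 h2 (x p) (x p') (hspan p) (hspan p')
    have R3 := fun j => map_basisSection_eq_sum_of_changeOfGenerators I ε g h1 h2 (x p) (x p') (s p) (s p') (hs p) (hs p')
      (e p) (e p') (he p) (he p') N hN j
    -- (g) an affine `W''` below `W p ⊓ W p' ⊓ j₀⁻¹ V''` around `φ q`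
    have hyj : φ q ∈ j₀ ⁻¹ᵁ (V'' : X₀.Opens) := by
      change j₀ (φ q) ∈ (V'' : X₀.Opens)
      rw [hpt]; exact hxV''
    obtain ⟨W''o, hW''aff, hyW'', hW''le⟩ := exists_isAffineOpen_mem_and_subset
      (show φ q ∈ ((W p : G₀.Opens) ⊓ W p') ⊓ j₀ ⁻¹ᵁ (V'' : X₀.Opens) from ⟨⟨hyq, hyq'⟩, hyj⟩)
    let W'' : G₀.affineOpens := ⟨W''o, hW''aff⟩
    have k1 : (W'' : G₀.Opens) ≤ W p := fun _ h => (hW''le h).1.1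
    have k2 : (W'' : G₀.Opens) ≤ W p' := fun _ h => (hW''le h).1.2
    have k3 : (W'' : G₀.Opens) ≤ j₀ ⁻¹ᵁ (V'' : X₀.Opens) := fun _ h => (hW''le h).2
    -- chart generators and their relation on `W''`
    let ℓ : Fin 2 → Γ(G₀, (W'' : G₀.Opens)) := fun l => j₀.appLE (V p : X₀.Opens) W'' (k1.trans (hWV p)) (x p l)
    let ℓ' : Fin 2 → Γ(G₀, (W'' : G₀.Opens)) := fun j => j₀.appLE (V p' : X₀.Opens) W'' (k2.trans (hWV p')) (x p' j)
    let Nb : Fin 2 → Fin 2 → Γ(G₀, (W'' : G₀.Opens)) := fun j l => j₀.appLE (V'' : X₀.Opens) W'' k3 (N j l)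
    have eℓ : ∀ l, ℓ l = j₀.appLE (V'' : X₀.Opens) W'' k3 (secRes X₀ h1 (x p l)) := fun l => by
      change _ = (X₀.presheaf.map (homOfLE h1).op ≫ j₀.appLE (V'' : X₀.Opens) W'' k3) (x p l)
      rw [Scheme.Hom.map_appLE]
    have eℓ' : ∀ j, ℓ' j = j₀.appLE (V'' : X₀.Opens) W'' k3 (secRes X₀ h2 (x p' j)) := fun j => by
      change _ = (X₀.presheaf.map (homOfLE h2).op ≫ j₀.appLE (V'' : X₀.Opens) W'' k3) (x p' j)
      rw [Scheme.Hom.map_appLE]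
    have hℓrel : ∀ j, ℓ' j = ∑ l, Nb j l * ℓ l := fun j => by
      rw [eℓ', hN j, map_sum]
      refine Finset.sum_congr rfl fun l _ => ?_
      rw [map_mul, eℓ]
    -- the two presentations of `𝒟'(W'')`
    have hℓW : ∀ l, secRes G₀ k1 (j₀.appLE (V p : X₀.Opens) (W p) (hWV p) (x p l)) = ℓ l := fun l =>
      secRes_appLE j₀ (V p) k1 (hWV p) (x p l)
    have hℓ'W : ∀ j, secRes G₀ k2 (j₀.appLE (V p' : X₀.Opens) (W p') (hWV p') (x p' j)) = ℓ' j := fun j =>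
      secRes_appLE j₀ (V p') k2 (hWV p') (x p' j)
    have hD1 : 𝒟'.ideal W'' = Ideal.span {∑ j, secRes G₀ k1 (α p j) * ℓ j} ⊔ (Ī.ideal W'') ^ 2 := by
      rw [← map_secRes_ideal 𝒟' k1, h𝒟W p, Ideal.map_sup, Ideal.map_pow, Ideal.map_span, Set.image_singleton,
        map_secRes_ideal Ī k1, map_sum]
      simp_rw [map_mul, hℓW]
    have hD2 : 𝒟'.ideal W'' = Ideal.span {∑ j, secRes G₀ k2 (α p' j) * ℓ' j} ⊔ (Ī.ideal W'') ^ 2 := by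
      rw [← map_secRes_ideal 𝒟' k2, h𝒟W p', Ideal.map_sup, Ideal.map_pow, Ideal.map_span, Set.image_singleton,
        map_secRes_ideal Ī k2, map_sum]
      simp_rw [map_mul, hℓ'W]
    let α'' : Fin 2 → Γ(G₀, (W'' : G₀.Opens)) := fun l => ∑ j, secRes G₀ k2 (α p' j) * Nb j l
    have hsum : ∑ j, secRes G₀ k2 (α p' j) * ℓ' j = ∑ l, α'' l * ℓ l := by
      simp_rw [hℓrel, Finset.mul_sum, ← mul_assoc]
      rw [Finset.sum_comm]
      simp_rw [← Finset.sum_mul]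
      rfl
    have hpres : Ideal.span {∑ j, secRes G₀ k1 (α p j) * ℓ j} ⊔ (Ī.ideal W'') ^ 2 =
        Ideal.span {∑ l, α'' l * ℓ l} ⊔ (Ī.ideal W'') ^ 2 := by
      rw [← hD1, hD2, hsum]
    have hĪ'' : Ī.ideal W'' = Ideal.span (Set.range ℓ) := by
      rw [← map_secRes_ideal Ī k1, hĪW p, Ideal.map_span, ← Set.range_comp]
      exact congrArg Ideal.span (congrArg Set.range (funext hℓW))
    have hu'' : (∑ j, secRes G₀ k1 (a p j) * secRes G₀ k1 (α p j) - 1) ∈ Ī.ideal W'' := by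
      have h := Ideal.mem_map_of_mem (secRes G₀ k1) (hu p)
      rw [map_secRes_ideal Ī k1, map_sub, map_one, map_sum] at h
      simpa only [map_mul] using h
    -- the downstairs transition unit
    obtain ⟨c, hc1, hc2, -⟩ := hdir' (φ q) (hyS q)
    obtain ⟨W₃, hW₃, hyW₃, u, hcong⟩ := exists_unit_of_presentations_eq Ī W'' hyW'' (hyS q) ⟨c, hc1, hc2⟩ ℓ hĪ''
      (fun j => secRes G₀ k1 (α p j)) (fun j => secRes G₀ k1 (a p j)) α'' hu'' hpres
    -- (h) the neighbourhood `V' := φ⁻¹ W₃` of `q`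
    have hz : φ ⁻¹ᵁ (W₃ : G₀.Opens) ≤ U p := fun _ h => k1 (hW₃ h)
    have hz' : φ ⁻¹ᵁ (W₃ : G₀.Opens) ≤ U p' := fun _ h => k2 (hW₃ h)
    have hzB : φ ⁻¹ᵁ (W₃ : G₀.Opens) ≤ g ⁻¹ᵁ (ε ⁻¹ᵁ (I.subschemeι ⁻¹ᵁ (V'' : X₀.Opens))) := by
      intro q' hq'
      change I.subschemeι (ε (g q')) ∈ (V'' : X₀.Opens)
      rw [← hpt]
      exact k3 (hW₃ hq')
    refine ⟨φ ⁻¹ᵁ (W₃ : G₀.Opens), hyW₃, hz, hz', φ.appLE W₃ (φ ⁻¹ᵁ (W₃ : G₀.Opens)) le_rfl u, ?_⟩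
    -- abbreviations on `V'`
    let Φ : Γ(G₀, (W₃ : G₀.Opens)) →+* Γ(Y', φ ⁻¹ᵁ (W₃ : G₀.Opens)) := (φ.appLE W₃ (φ ⁻¹ᵁ (W₃ : G₀.Opens)) le_rfl).hom
    let T : Fin 2 → Γ(G, φ ⁻¹ᵁ (W₃ : G₀.Opens)) := fun l => G.presheaf.map (homOfLE hz ≫ homOfLE (hUV p)).op (bS p l)
    let nb : Fin 2 → Fin 2 → Γ(Y', φ ⁻¹ᵁ (W₃ : G₀.Opens)) := fun j l =>
      Y'.presheaf.map (homOfLE hzB).op (g.app _ (ε.app _ (I.subschemeι.app (V'' : X₀.Opens) (N j l))))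
    -- (K2) the frame relation restricted to `V'`
    have K2 : ∀ j, G.presheaf.map (homOfLE hz' ≫ homOfLE (hUV p')).op (bS p' j) = ∑ l, nb j l • T l := by
      intro j
      rw [presheaf_map_congr G (homOfLE hz' ≫ homOfLE (hUV p'))
        (homOfLE hzB ≫ (Opens.map g.base).map ((Opens.map ε.base).map ((Opens.map I.subschemeι.base).map (homOfLE h2)))),
        op_comp, G.presheaf.map_comp]
      change G.presheaf.map (homOfLE hzB).op (G.presheaf.map _ (bS p' j)) = _
      rw [R3 j, map_sum]
      refine Finset.sum_congr rfl fun l _ => ?_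
      rw [Scheme.Modules.map_smul, presheaf_map_map]
      exact congrArg _ (presheaf_map_congr G _ _ _)
    -- (K1) the coefficient identity `Σ_j ab'_j · nb_jl = ū · ab_l` on `V'`
    have S1 : ∀ j, Y'.presheaf.map (homOfLE hz').op (ab p' j) = Φ (secRes G₀ (hW₃.trans k2) (α p' j)) := fun j =>
      appLE_res (hW₃.trans k2) (homOfLE hz') le_rfl le_rfl (α p' j)
    have S2 : ∀ l, Y'.presheaf.map (homOfLE hz).op (ab p l) = Φ (secRes G₀ (hW₃.trans k1) (α p l)) := fun l =>
      appLE_res (hW₃.trans k1) (homOfLE hz) le_rfl le_rfl (α p l)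
    have S3 : ∀ j l, nb j l = Φ (secRes G₀ hW₃ (Nb j l)) := fun j l => by
      change _ = Φ (secRes G₀ hW₃ (j₀.appLE (V'' : X₀.Opens) W'' k3 (N j l)))
      rw [secRes_appLE, appLE_j₀ (hW₃.trans k3) le_rfl hzB]
    have S4 : ∀ l, Φ (secRes G₀ hW₃ (α'' l)) = Φ u * Φ (secRes G₀ (hW₃.trans k1) (α p l)) := fun l => by
      have h := appLE_comp_subschemeι_eq_of_sub_mem Ī ψ W₃ _ le_rfl (hcong l)
      rw [map_mul, secRes_secRes] at h
      exact h
    have K1 : ∀ l, ∑ j, Y'.presheaf.map (homOfLE hz').op (ab p' j) * nb j l = Φ u * Y'.presheaf.map (homOfLE hz).op (ab p l) := by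
      intro l
      rw [S2, ← S4]
      simp_rw [S1, S3, ← map_mul, ← map_sum Φ]
      congr 1
      change _ = secRes G₀ hW₃ (∑ j, secRes G₀ k2 (α p' j) * Nb j l)
      rw [map_sum]
      refine Finset.sum_congr rfl fun j _ => ?_
      rw [map_mul, secRes_secRes]
    -- the module computation
    rw [map_w p' (homOfLE hz'), map_w p (homOfLE hz), Finset.smul_sum]
    simp_rw [K2, Finset.smul_sum, smul_smul]
    rw [Finset.sum_comm]
    refine Finset.sum_congr rfl fun l _ => ?_
    rw [← Finset.sum_smul, K1 l]
  -- Step 5: conclusion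
  refine ⟨U, hU, w, ρ, hρ, hprop_of_locally w ρ hρ hloc, fun p => ⟨V p, x p, s p, hreg p, hspan p, hs p, hUV p, W p, hWV p,
    le_rfl, α p, ?_, h𝒟W p⟩⟩
  refine Finset.sum_congr rfl fun j _ => ?_
  congr 1
  change G.presheaf.map (homOfLE (hUV p)).op (basisSection (E := G) (pullbackFrame g (pullbackFrame ε (e p))) j) = _
  rw [basisSection_pullbackFrame, basisSection_pullbackFrame, he p j]

end Summit.ResolutionOfSingularities.ResolutionOfSingularities.Cruxes.EquisingularLiftNat.P1VB

end
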